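import Mathlib.Analysis.Analytic.Order
import Mathlib.Analysis.Calculus.IteratedDeriv.Lemmas
import Mathlib.Analysis.SpecialFunctions.Pow.Real
import Mathlib.Topology.Order.IntermediateValue
import HarnessLib

/-!
# The sign of the leading Taylor coefficient at the centre: "what the Riemann hypothesis predicts"

Topic `NumberTheory/LFunctions`, companion of `CentralOrderForcedByStructure` (namespace
`Literature.NumberTheory.LFunctions.CentralOrder`). Gross–Zagier, *Heegner points and derivatives of
`L`-series*, Invent. Math. 84 (1986), V.(1.1) Corollary and the remark following it (p. 309):
"`L'(f, χ, 1) ≥ 0`. … Notice that Corollary (1.1) is what would be predicted by the Riemann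
hypothesis for `L(f, χ, s)`, according to which the largest zero of the real function `L(f, χ, s)`
on the real axis should occur at `s = 1`."

The prediction, made a theorem about real functions: let `Λ : ℝ → ℝ` be analytic at the centre `a`
with `Λ^{(k)}(a) = 0` for `k < n` and `Λ^{(n)}(a) ≠ 0` (order of vanishing exactly `n`).

* `iteratedDeriv_pos_of_eventually_pos` — if `Λ > 0` immediately to the right of `a`, then
  `Λ^{(n)}(a) > 0` (Taylor: `Λ(x) = (x - a)ⁿ (Λ^{(n)}(a)/n! + O(x - a))`);
* `iteratedDeriv_pos_of_forall_ne_zero` — if `Λ` is continuous on `(a, ∞)`, has NO ZERO on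
  `(a, ∞)` ("the largest zero … on the real axis should occur at" the centre — under the Riemann
  hypothesis for `Λ` every zero has real part `a`, so none lies on `(a, ∞)`) and is positive at one
  point of `(a, ∞)` (e.g. far to the right, in the region of absolute convergence of an Euler
  product), then `Λ^{(n)}(a) > 0`: by the intermediate value theorem `Λ > 0` on all of `(a, ∞)`.

For `n = 1` this is "`L'(1) ≥ 0`" (indeed `> 0` when the zero is simple); Gross–Zagier prove the
`n = 1` inequality unconditionally for `L(f, χ, s)` (tree: `lDerivEK_nonneg`,
`GrossZagierLDerivNonneg.lean`, the case `E/ℚ`, `χ = 1`). Real-variable statements; for a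
completed `L`-function real on the real axis apply them to its restriction `x ↦ Λ(x)`.

## References

* [GrossZagierInvent1986] B. H. Gross, D. B. Zagier, Invent. Math. 84 (1986), V.(1.1) and the
  remark following it, p. 309.
-/

noncomputable section

open Filter Set

open scoped Topology

namespace Literature.NumberTheory.LFunctions

namespace CentralOrder

/-! ### At the origin -/

/-- **Leading coefficient positive from positivity on the right, at `0`.** If `f : ℝ → ℝ` is
analytic at `0` with `f^{(k)}(0) = 0` for `k < n`, `f^{(n)}(0) ≠ 0`, and `f(x) > 0` for all small
`x > 0`, then `f^{(n)}(0) > 0`: by Taylor's theorem (Mathlib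
`AnalyticAt.exists_eventuallyEq_sum_add_pow_mul`) `f(x) = xⁿ (f^{(n)}(0)/n! + x F(x))` near `0` with
`F` analytic, so `f^{(n)}(0)/n! + x F(x) > 0` for small `x > 0`, and letting `x → 0⁺` gives
`f^{(n)}(0)/n! ≥ 0`. [cite: GrossZagierInvent1986, V.(1.1) and remark (p. 309)] -/
theorem iteratedDeriv_pos_of_eventually_pos_zero {f : ℝ → ℝ} (hf : AnalyticAt ℝ f 0) {n : ℕ}
    (hlow : ∀ k < n, iteratedDeriv k f 0 = 0) (hne : iteratedDeriv n f 0 ≠ 0)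
    (hpos : ∀ᶠ x in 𝓝[>] (0 : ℝ), 0 < f x) : 0 < iteratedDeriv n f 0 := by
  obtain ⟨F, hF, hev⟩ := hf.exists_eventuallyEq_sum_add_pow_mul (n + 1)
  set c : ℝ := iteratedDeriv n f 0 / n.factorial with hc
  have hfac : (0 : ℝ) < n.factorial := by exact_mod_cast n.factorial_pos
  -- near `0`: `f x = x ^ n * (c + x * F x)`
  have hev' : ∀ᶠ x in 𝓝 (0 : ℝ), f x = x ^ n * (c + x * F x) := by
    filter_upwards [hev] with x hx
    rw [hx, Finset.sum_range_succ, Finset.sum_eq_zero]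
    · simp only [smul_eq_mul, zero_add, hc]
      ring
    · intro i hi
      rw [hlow i (Finset.mem_range.mp hi), smul_zero]
  -- `c + x F x → c` and is `> 0` for small `x > 0`
  have hlim : Tendsto (fun x : ℝ ↦ c + x * F x) (𝓝[>] 0) (𝓝 c) := by
    have h : Tendsto (fun x : ℝ ↦ c + x * F x) (𝓝 0) (𝓝 (c + 0 * F 0)) :=
      tendsto_const_nhds.add (tendsto_id.mul hF.continuousAt.tendsto)
    rw [zero_mul, add_zero] at h
    exact h.mono_left nhdsWithin_le_nhds
  have hgpos : ∀ᶠ x in 𝓝[>] (0 : ℝ), 0 < c + x * F x := by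
    filter_upwards [hpos, hev'.filter_mono nhdsWithin_le_nhds, self_mem_nhdsWithin] with x hx hx'
      (hx0 : 0 < x)
    rw [hx'] at hx
    exact pos_of_mul_pos_right hx (pow_nonneg hx0.le n)
  have hge : 0 ≤ c := ge_of_tendsto hlim (hgpos.mono fun _ h ↦ h.le)
  have hcne : c ≠ 0 := div_ne_zero hne hfac.ne'
  have hcpos : 0 < c := lt_of_le_of_ne hge hcne.symm
  have := mul_pos hcpos hfac
  rwa [hc, div_mul_cancel₀ _ hfac.ne'] at this

/-! ### At a general centre -/

variable {Λ : ℝ → ℝ} {a : ℝ} {n : ℕ}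

/-- **Leading coefficient positive from positivity on the right.** If `Λ : ℝ → ℝ` is analytic at
`a` with `Λ^{(k)}(a) = 0` for `k < n`, `Λ^{(n)}(a) ≠ 0` (order of vanishing exactly `n`), and
`Λ(x) > 0` for all `x > a` close to `a`, then `Λ^{(n)}(a) > 0` (translate to `0`,
`iteratedDeriv_pos_of_eventually_pos_zero`, Mathlib `iteratedDeriv_comp_add_const`).
[cite: GrossZagierInvent1986, V.(1.1) and remark (p. 309)] -/
theorem iteratedDeriv_pos_of_eventually_pos (hΛ : AnalyticAt ℝ Λ a)
    (hlow : ∀ k < n, iteratedDeriv k Λ a = 0) (hne : iteratedDeriv n Λ a ≠ 0)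
    (hpos : ∀ᶠ x in 𝓝[>] a, 0 < Λ x) : 0 < iteratedDeriv n Λ a := by
  -- translate: `f z = Λ (z + a)`
  set f : ℝ → ℝ := fun z ↦ Λ (z + a) with hf_def
  have hf : AnalyticAt ℝ f 0 := by
    have hg : AnalyticAt ℝ (fun z : ℝ ↦ z + a) 0 := by fun_prop
    exact hΛ.comp_of_eq hg (by simp)
  have hder : ∀ k, iteratedDeriv k f 0 = iteratedDeriv k Λ a := by
    intro k
    have h := congrFun (iteratedDeriv_comp_add_const k Λ a) 0
    simpa [hf_def] using h
  have hlow' : ∀ k < n, iteratedDeriv k f 0 = 0 := fun k hk ↦ (hder k).trans (hlow k hk)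
  have hne' : iteratedDeriv n f 0 ≠ 0 := by rw [hder n]; exact hne
  have hpos' : ∀ᶠ z in 𝓝[>] (0 : ℝ), 0 < f z := by
    -- `z ↦ z + a` maps `𝓝[>] 0` to `𝓝[>] a`
    have ht : Tendsto (fun z : ℝ ↦ z + a) (𝓝[>] (0 : ℝ)) (𝓝[>] a) := by
      refine tendsto_nhdsWithin_of_tendsto_nhds_of_eventually_within _ ?_ ?_
      · have h : Tendsto (fun z : ℝ ↦ z + a) (𝓝 0) (𝓝 (0 + a)) :=
          tendsto_id.add tendsto_const_nhds
        rw [zero_add] at h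
        exact h.mono_left nhdsWithin_le_nhds
      · filter_upwards [self_mem_nhdsWithin] with z (hz : 0 < z)
        exact show a < z + a by linarith
    exact ht.eventually hpos
  rw [← hder n]
  exact iteratedDeriv_pos_of_eventually_pos_zero hf hlow' hne' hpos'

/-- **"What would be predicted by the Riemann hypothesis"** (Gross–Zagier 1986, remark after
V.(1.1)): let `Λ : ℝ → ℝ` be continuous on `(a, ∞)`, analytic at the centre `a` with
`Λ^{(k)}(a) = 0` for `k < n` and `Λ^{(n)}(a) ≠ 0`. If `Λ` has NO ZERO on `(a, ∞)` ("the largest zero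
of the real function … on the real axis should occur at" the centre — e.g. because every zero has
real part `a`) and `Λ(x₀) > 0` at some `x₀ > a` (e.g. in the region of absolute convergence), then
`Λ^{(n)}(a) > 0`. Proof: by the intermediate value theorem on the connected set `(a, ∞)` the
zero-free continuous `Λ` has constant sign there, positive at `x₀`; conclude by
`iteratedDeriv_pos_of_eventually_pos`. For `n = 1`: a simple central zero and no real zero to the
right force `Λ'(a) > 0`. [cite: GrossZagierInvent1986, V.(1.1) and remark (p. 309)] -/
theorem iteratedDeriv_pos_of_forall_ne_zero (hΛ : AnalyticAt ℝ Λ a) (hcont : ContinuousOn Λ (Ioi a))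
    (hlow : ∀ k < n, iteratedDeriv k Λ a = 0) (hne : iteratedDeriv n Λ a ≠ 0)
    (hnz : ∀ x, a < x → Λ x ≠ 0) {x₀ : ℝ} (hx₀ : a < x₀) (hpos₀ : 0 < Λ x₀) :
    0 < iteratedDeriv n Λ a := by
  -- `Λ > 0` on `(a, ∞)`: otherwise IVT produces a zero between `x₀` and a point where `Λ < 0`
  have hposIoi : ∀ x, a < x → 0 < Λ x := by
    intro x hx
    rcases lt_trichotomy (Λ x) 0 with hneg | hzero | hposx
    · exfalso
      have hpre : IsPreconnected (Ioi a) := isPreconnected_Ioi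
      obtain ⟨z, hz, hz0⟩ := hpre.intermediate_value₂ hx hx₀ hcont continuousOn_const
        hneg.le hpos₀.le
      exact hnz z hz hz0
    · exact absurd hzero (hnz x hx)
    · exact hposx
  refine iteratedDeriv_pos_of_eventually_pos hΛ hlow hne ?_
  filter_upwards [self_mem_nhdsWithin] with x (hx : a < x)
  exact hposIoi x hx

/-- **Order one**: a simple central zero (`Λ(a) = 0`, `Λ'(a) ≠ 0`), no zero on `(a, ∞)` and a
positive value there force `Λ'(a) > 0` — Gross–Zagier's reading of their Cor. V.(1.1)
`L'(f, χ, 1) ≥ 0` as the prediction of the Riemann hypothesis for `L(f, χ, s)`.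
[cite: GrossZagierInvent1986, V.(1.1) and remark (p. 309)] -/
theorem deriv_pos_of_forall_ne_zero (hΛ : AnalyticAt ℝ Λ a) (hcont : ContinuousOn Λ (Ioi a))
    (h0 : Λ a = 0) (h1 : deriv Λ a ≠ 0) (hnz : ∀ x, a < x → Λ x ≠ 0) {x₀ : ℝ} (hx₀ : a < x₀)
    (hpos₀ : 0 < Λ x₀) : 0 < deriv Λ a := by
  have h := iteratedDeriv_pos_of_forall_ne_zero (n := 1) hΛ hcont
    (fun k hk ↦ by
      have hk0 : k = 0 := by omega
      subst hk0
      simpa using h0)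
    (by simpa using h1) hnz hx₀ hpos₀
  simpa using h

end CentralOrder

end Literature.NumberTheory.LFunctions
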